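import Literature.AnabelianGeometry.SemiGraphs.TemperedCurveDeltaCharacteristic
import Literature.AnabelianGeometry.SemiGraphs.TemperedDeltaCompletion
import Literature.IUT.HodgeTheaters.StableCurveTemperedDataOfSpecialFibre
import Literature.AnabelianGeometry.AbsoluteAnabelian.MLFGaloisGroupsProofs
import Literature.AnabelianGeometry.AbsoluteAnabelian.AbsTopIThm26vFullTransportProofs
import Literature.AnabelianGeometry.AbsoluteAnabelian.AbsTopIThm26vFullSigmaProofs
import HarnessLib

/-!
# [SemiAnbd] §6 / [AbsTopI] Thm 2.6 (v): (H1) for `TemperedCurve p` from print's inputs ON THE CURVE'S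
# OWN PROFINITE COMPLETION `1 → Δ_X → Π_{X_K} → G_K → 1`

S. Mochizuki, *Semi-graphs of anabelioids*, Publ. RIMS 42 (2006), §6 p. 69 ("`Π_{X_K} := (Π^temp_{X_K})^∧`,
`Δ_X := (Δ^temp_X)^∧`") and *Topics in absolute anabelian geometry I* (2012), Thm 2.6 (v) p. 22 with its
printed inputs Prop 2.2 (`Δ` topologically finitely generated) and the rank computation of [AbsAnab] Lemma
1.1.4 (ii) (`δ¹_l(Π′) − δ¹_l(G′)` independent of `l`).

Sequel (proof-only, no definitions, no named facts) of `TemperedCurveDeltaCharacteristic.lean` (abc-iut-w6-d027,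
p439452), which reduced (H1) «`Δ^temp_X ⊆ Π^temp_{X_K}` characteristic» for `X : TemperedCurve p` to ONE
[AbsTopI] Thm 2.6 (v) regime on SOME compatible completion package `(E, B, ι, g)`.  Under L3's parameter
bundle ("`Π^temp` tempered", "Galois-countable": `IsTempered X.PiTemp` + first countability, resp.
`d : X.GroupLevelData`) the completed sequence `1 → Δ_X → Π_{X_K} → G_K → 1` of the interface IS exact
(abc-iut-w5-d139's `TemperedCurve.ker_augHat_eq_deltaHat(_of_isTempered)`, p419295; `Π_{X_K} → G_K` lands in
`G_K` by abc-iut-L5's `StableCurveTemperedData.OfSpecialFibre.augHat_mem_GK`), so the CANONICAL package is the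
curve's own `(Π_{X_K}, G_K ⥲ Gal(K̄_K/K), augHat)` and the regime hypotheses can be stated on it:

* `TemperedCurve.isTopCharacteristic_deltaTemp_of_isTempered_of_hat_regime` — (H1) for `X` from
  (a) `Δ_X` topologically finitely generated ([AbsTopI] Prop 2.2 for the profinite geometric fundamental group,
  interface `X.DeltaHat`) and (b) the rank constancy «`δ¹_{l₁}(Π′) − δ¹_{l₁}(augHat Π′) = δ¹_{l₂}(Π′) −
  δ¹_{l₂}(augHat Π′)` for every open `Π′ ≤ Π_{X_K}`» (= `CoinvariantRankConstant`, FACT-LIST F-0001, SPELLED OUT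
  at the instance `Π_{X_K} → G_K ≤ G_{ℚ_p}` over the interface fields `PiHat`, `augHat` — no new name), given
  `Π^temp_{X_K}` tempered and Galois-countable;
* `TemperedCurve.isTopCharacteristic_deltaTemp_of_groupLevelData_of_hat_regime` — the same over
  `d : X.GroupLevelData`.

Inside the proof the extension `E_X := (Π_{X_K}, Gal(K̄_K/K), galoisIdentification ∘ augHat)` with MLF base data
`(p, K, id)` is assembled, `Δ_{E_X} = Δ_X` is `ker_augHat_eq_deltaHat`, (b) is transported to
`E_X.CoinvariantRankConstant` along the topological isomorphisms `augHat(Π′) ⥲ aug_{E_X}(Π′)` (free pro-`l` rank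
is an invariant, `freeProlRank_eq_of_continuousMulEquiv`), L4's
`FundamentalExtension.preservesGeom_of_coinvariantRankConstant` gives «`Δ_X ⊆ Π_{X_K}` characteristic», and
p439452's `isTopCharacteristic_deltaTemp_of_deltaHat` descends it to `Π^temp_{X_K}`.

HONEST SCOPE: (a) and (b) are print's inputs for the PROFINITE `Π_{X_K}` of a hyperbolic curve over an MLF and are
NOT carried by the abstract interface `TemperedCurve p`; they stay explicit hypotheses (F-0001 is admissible at
named instances only).  Nothing here bears on [IUTchIII] Cor. 3.12; no side is taken; typed ≠ proved elsewhere.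
-/

noncomputable section

namespace Literature.AnabelianGeometry.SemiGraphs

open Literature.AnabelianGeometry.AbsoluteAnabelian
open Literature.AnabelianGeometry.EtaleTheta (IsTopCharacteristic)

namespace TemperedCurve

variable {p : ℕ} [Fact p.Prime] (X : TemperedCurve p)

/-- **(H1) for `X` from [AbsTopI] Prop 2.2 + the [AbsAnab] Lemma 1.1.4 (ii) rank constancy ON THE CURVE'S OWN
`Π_{X_K}`**, for `Π^temp_{X_K}` tempered and Galois-countable: if `Δ_X = (Δ^temp_X)^∧ ≤ Π_{X_K}` is
topologically finitely generated and, for every open subgroup `Π′ ≤ Π_{X_K}`, the difference of free pro-`l`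
ranks `δ¹_l(Π′) − δ¹_l(augHat Π′)` does not depend on the prime `l` (FACT-LIST F-0001 `CoinvariantRankConstant`
spelled out at the instance `augHat : Π_{X_K} → G_K ≤ G_{ℚ_p}`), then every automorphism of the topological
group `Π^temp_{X_K}` carries `Δ^temp_X` onto itself.  Route: exactness `Ker(augHat) = Δ_X`
(`ker_augHat_eq_deltaHat_of_isTempered`), the canonical extension `(Π_{X_K}, Gal(K̄_K/K), ι_K ∘ augHat)` with MLF
base `(p, K, id)`, [AbsTopI] Thm 2.6 (v) (`preservesGeom_of_coinvariantRankConstant`), descent along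
`Π^temp_{X_K} ↪ Π_{X_K}` (`isTopCharacteristic_deltaTemp_of_deltaHat`).
[cite: MochizukiAbsTopI2012, Thm 2.6 (v) p.22] [cite: MochizukiSemiAnbd2006, §6 p.69] -/
theorem isTopCharacteristic_deltaTemp_of_isTempered_of_hat_regime (hT : IsTempered X.PiTemp)
    [FirstCountableTopology X.PiTemp] (hΔ : IsTopologicallyFinitelyGenerated X.DeltaHat)
    (hc : ∀ P : Subgroup X.PiHat, IsOpen (P : Set X.PiHat) →
      ∀ (l₁ l₂ : ℕ) [Fact l₁.Prime] [Fact l₂.Prime],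
        freeProlRank P l₁ - freeProlRank (P.map X.augHat.toMonoidHom) l₁ =
          freeProlRank P l₂ - freeProlRank (P.map X.augHat.toMonoidHom) l₂) :
    IsTopCharacteristic X.PiTemp X.DeltaTemp := by
  classical
  -- `Π_{X_K}` is profinite (interface axiom `isProfiniteCompletion_toHat`)
  have hι := X.isProfiniteCompletion_toHat
  haveI : CompactSpace X.PiHat := hι.compactSpace
  haveI : T2Space X.PiHat := hι.t2Space
  haveI : TotallyDisconnectedSpace X.PiHat := hι.totallyDisconnectedSpace
  haveI : FiniteDimensional ℚ_[p] X.K := X.finiteDimensional_K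
  haveI : CharZero X.K := charZero_of_injective_algebraMap (algebraMap ℚ_[p] X.K).injective
  -- `augHat : Π_{X_K} → G_{ℚ_p}` lands in `G_K`; corestrict, then identify `G_K ⥲ Gal(K̄_K/K)`
  have hmem : ∀ y : X.PiHat, X.augHat y ∈ X.GK :=
    Literature.IUT.HodgeTheaters.StableCurveTemperedData.OfSpecialFibre.augHat_mem_GK X
  let aGK : X.PiHat →ₜ* X.GK :=
    { toFun := fun y => ⟨X.augHat y, hmem y⟩
      map_one' := Subtype.ext (map_one X.augHat)
      map_mul' := fun a b => Subtype.ext (map_mul X.augHat a b)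
      continuous_toFun := X.augHat.continuous.subtype_mk _ }
  have haGK : ∀ y, ((aGK y : X.GK) : GQp p) = X.augHat y := fun _ => rfl
  let eK := X.galoisIdentification
  let ψ : X.PiHat →ₜ* Field.absoluteGaloisGroup X.K :=
    { toMonoidHom := eK.toMulEquiv.toMonoidHom.comp aGK.toMonoidHom
      continuous_toFun := eK.continuous.comp aGK.continuous }
  have hψ : ∀ y, ψ y = eK (aGK y) := fun _ => rfl
  have haGK_toHat : ∀ x, aGK (X.toHat x) = X.augGK x := fun x =>
    Subtype.ext (by rw [haGK, coe_augGK_apply, X.augHat_comp])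
  have hsurj : Function.Surjective ψ := by
    intro y
    obtain ⟨x, hx⟩ := X.augK_surjective eK y
    refine ⟨X.toHat x, ?_⟩
    rw [hψ, haGK_toHat]
    exact hx
  -- the canonical extension `E_X = (Π_{X_K}, Gal(K̄_K/K), ι_K ∘ augHat)` with MLF base `(p, K, id)`
  let E : FundamentalExtension.{0} :=
    { arith := ProfiniteGrp.of X.PiHat
      gal := absoluteGaloisGrp X.K
      aug := ψ
      aug_surjective := hsurj }
  let B : E.MLFBase := { p := p, K := X.K, galIso := ContinuousMulEquiv.refl _ }
  -- `Δ_{E_X} = Ker(augHat) = Δ_X`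
  have hkerψ : ∀ y : X.PiHat, ψ y = 1 ↔ X.augHat y = 1 := by
    intro y
    rw [hψ, ← map_one eK, eK.injective.eq_iff, Subtype.ext_iff, haGK]
    rfl
  have hgeom : E.geom = X.DeltaHat := by
    rw [← X.ker_augHat_eq_deltaHat_of_isTempered hT]
    ext y
    rw [FundamentalExtension.mem_geom, MonoidHom.mem_ker]
    exact hkerψ y
  have hΔE : IsTopologicallyFinitelyGenerated E.geom := by
    rw [hgeom]
    exact hΔ
  -- transport of the rank constancy: `augHat(Π′) ⥲ ψ(Π′)` topologically, for every open `Π′`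
  have hrank : ∀ (P : Subgroup X.PiHat), IsOpen (P : Set X.PiHat) → ∀ (l : ℕ) [Fact l.Prime],
      freeProlRank (P.map X.augHat.toMonoidHom) l = freeProlRank (P.map ψ.toMonoidHom) l := by
    intro P hP l _
    -- the comparison homomorphism `augHat(Π′) → ψ(Π′)`, `z ↦ ι_K z`
    have hzGK : ∀ z : P.map X.augHat.toMonoidHom, (z : GQp p) ∈ X.GK := by
      rintro ⟨_, y, hy, rfl⟩
      exact hmem y
    have hzmem : ∀ z : P.map X.augHat.toMonoidHom,
        eK ⟨(z : GQp p), hzGK z⟩ ∈ P.map ψ.toMonoidHom := by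
      rintro ⟨_, y, hy, rfl⟩
      exact ⟨y, hy, rfl⟩
    let φ : P.map X.augHat.toMonoidHom →* P.map ψ.toMonoidHom :=
      { toFun := fun z => ⟨eK ⟨(z : GQp p), hzGK z⟩, hzmem z⟩
        map_one' := Subtype.ext (by
          change eK ⟨((1 : P.map X.augHat.toMonoidHom) : GQp p), _⟩ = 1
          rw [← map_one eK]
          rfl)
        map_mul' := fun a b => Subtype.ext (by
          change eK ⟨((a * b : P.map X.augHat.toMonoidHom) : GQp p), _⟩ = eK _ * eK _
          rw [← map_mul eK]
          rfl) }
    have hφ : ∀ z, ((φ z : P.map ψ.toMonoidHom) : Field.absoluteGaloisGroup X.K) =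
        eK ⟨(z : GQp p), hzGK z⟩ := fun _ => rfl
    have hφinj : Function.Injective φ := by
      intro a b h
      have h' := congrArg (fun w : P.map ψ.toMonoidHom => (w : Field.absoluteGaloisGroup X.K)) h
      simp only [hφ] at h'
      exact Subtype.ext (congrArg (fun w : X.GK => (w : GQp p)) (eK.injective h'))
    have hφsurj : Function.Surjective φ := by
      rintro ⟨_, y, hy, rfl⟩
      exact ⟨⟨X.augHat y, y, hy, rfl⟩, Subtype.ext rfl⟩
    have hφcont : Continuous φ := by
      apply Continuous.subtype_mk
      exact eK.continuous.comp (continuous_subtype_val.subtype_mk _)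
    -- source compact (closed subgroup image of an open, hence closed, subgroup of the profinite `Π_{X_K}`),
    -- target Hausdorff: the continuous bijective homomorphism is a topological isomorphism
    haveI : CompactSpace (P.map X.augHat.toMonoidHom) := by
      have hPc : IsCompact (P : Set X.PiHat) := (Subgroup.isClosed_of_isOpen P hP).isCompact
      have himg : IsCompact ((P.map X.augHat.toMonoidHom : Subgroup (GQp p)) : Set (GQp p)) := by
        rw [Subgroup.coe_map]
        exact hPc.image X.augHat.continuous
      exact isCompact_iff_compactSpace.mp himg
    let eφ : P.map X.augHat.toMonoidHom ≃ P.map ψ.toMonoidHom := Equiv.ofBijective φ ⟨hφinj, hφsurj⟩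
    let hφ' : P.map X.augHat.toMonoidHom ≃ₜ P.map ψ.toMonoidHom :=
      Continuous.homeoOfEquivCompactToT2 (f := eφ) hφcont
    let e : P.map X.augHat.toMonoidHom ≃ₜ* P.map ψ.toMonoidHom :=
      { MulEquiv.ofBijective φ ⟨hφinj, hφsurj⟩ with
        continuous_toFun := hφcont
        continuous_invFun := hφ'.symm.continuous }
    exact freeProlRank_eq_of_continuousMulEquiv e l
  have hcE : E.CoinvariantRankConstant := by
    intro P hP l₁ l₂ _ _
    have h := hc P hP l₁ l₂
    rw [hrank P hP l₁, hrank P hP l₂] at h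
    exact h
  -- [AbsTopI] Thm 2.6 (v) on `E_X`, then descent along `Π^temp_{X_K} ↪ Π_{X_K}`
  refine X.isTopCharacteristic_deltaTemp_of_deltaHat ?_
  intro Φ
  have hpres := FundamentalExtension.preservesGeom_of_coinvariantRankConstant B B hΔE hcE hΔE hcE Φ
  change E.geom.map Φ.toMulEquiv.toMonoidHom = E.geom at hpres
  rw [hgeom] at hpres
  exact hpres

/-- **(H1) for `X` over L3's parameter bundle** `d : X.GroupLevelData` ("`Π^temp` tempered",
"Galois-countable", ruling η′) **from [AbsTopI] Prop 2.2 + the rank constancy on the curve's own `Π_{X_K}`.**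
[cite: MochizukiAbsTopI2012, Thm 2.6 (v) p.22] [cite: MochizukiSemiAnbd2006, §6 p.69] -/
theorem isTopCharacteristic_deltaTemp_of_groupLevelData_of_hat_regime (d : X.GroupLevelData)
    (hΔ : IsTopologicallyFinitelyGenerated X.DeltaHat)
    (hc : ∀ P : Subgroup X.PiHat, IsOpen (P : Set X.PiHat) →
      ∀ (l₁ l₂ : ℕ) [Fact l₁.Prime] [Fact l₂.Prime],
        freeProlRank P l₁ - freeProlRank (P.map X.augHat.toMonoidHom) l₁ =
          freeProlRank P l₂ - freeProlRank (P.map X.augHat.toMonoidHom) l₂) :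
    IsTopCharacteristic X.PiTemp X.DeltaTemp := by
  haveI := d.secondCountableTopology
  exact X.isTopCharacteristic_deltaTemp_of_isTempered_of_hat_regime d.isTempered hΔ hc

/-! ### (H1) from a compatible completion package in the GENERAL-`Θ` [AbsTopI] Thm 2.6 (v) regime

Appended by abc-iut-w6-d027 gen 3 (row «THM26VFULL-TRANSPORT»): with `preservesGeom_of_thm26vFull`
(`AbsTopIThm26vFullTransportProofs.lean`: `Θ`, `ζ̃` and hence `Δ` are "group-theoretic"), the typed general
form `FundamentalExtension.Thm26vFull` of Thm 2.6 (v) on a completion package feeds (H1) directly — e.g.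
abc-iut-w6-d034's `MLFBase.thm26vFull_of_exists_prime_not_mem` (`Δ_E` pro-`Σ` with a prime outside `Σ`,
`Δ_E` and `Π_E` topologically finitely generated) or `MLFBase.thm26vFull_of_rank_of_thm26iii_open`
(`Σ = Primes` regime). -/

/-- **(H1) from a compatible completion package satisfying [AbsTopI] Thm 2.6 (v) in its GENERAL-`Θ` form**
(`E.Thm26vFull B`: `ζ̃(Π_E) = [k : ℚ_p]` and `Δ_E = ⋂ {H open : ζ̃(H) = [Π_E : H]·ζ̃(Π_E)}`): every automorphism
of topological groups of `Π^temp_{X_K}` carries `Δ^temp_X` onto itself.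
[cite: MochizukiAbsTopI2012, Thm 2.6 (v) p.22] -/
theorem isTopCharacteristic_deltaTemp_of_completion_thm26vFull (E : FundamentalExtension.{0})
    (B : E.MLFBase) (hv : E.Thm26vFull B) (ι : X.PiTemp →ₜ* E.arith) (hι : IsProfiniteCompletion ι)
    (g : X.GK →* E.gal) (hg : Function.Injective g) (h : ∀ x, E.aug (ι x) = g (X.augGK x)) :
    IsTopCharacteristic X.PiTemp X.DeltaTemp :=
  X.isTopCharacteristic_deltaTemp_of_completion_compatible E ι hι g hg h
    fun φ => FundamentalExtension.geom_map_eq_self_of_thm26vFull hv φ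

/-- **(H1) from a compatible completion package with `Δ_E` pro-`Σ` for a `Σ` MISSING a prime**, `Δ_E` and
`Π_E` topologically finitely generated — abc-iut-w6-d034's `MLFBase.thm26vFull_of_exists_prime_not_mem`
([AbsTopI] Thm 2.6 (v) general form in the regime `Θ = Δ`) composed with the transport.  (NOT the regime of
the genuine `Π_{X_K}` of a hyperbolic curve, whose `Δ_X` is the FULL profinite completion; recorded for
pro-`Σ` packages.) [cite: MochizukiAbsTopI2012, Thm 2.6 (v) p.22] -/
theorem isTopCharacteristic_deltaTemp_of_completion_proSigma_missing_prime (E : FundamentalExtension.{0})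
    (B : E.MLFBase) {Sigma : Set ℕ} (hSigsub : Sigma ⊆ {q | q.Prime}) (hq : ∃ q : ℕ, q.Prime ∧ q ∉ Sigma)
    (hΔE : E.GeomTFG) (hPiE : IsTopologicallyFinitelyGenerated E.arith) (hpro : IsProSet E.geom Sigma)
    (ι : X.PiTemp →ₜ* E.arith) (hι : IsProfiniteCompletion ι) (g : X.GK →* E.gal)
    (hg : Function.Injective g) (h : ∀ x, E.aug (ι x) = g (X.augGK x)) :
    IsTopCharacteristic X.PiTemp X.DeltaTemp :=
  X.isTopCharacteristic_deltaTemp_of_completion_thm26vFull E B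
    (FundamentalExtension.MLFBase.thm26vFull_of_exists_prime_not_mem B hSigsub hq hΔE hPiE hpro) ι hι g hg h

end TemperedCurve

end Literature.AnabelianGeometry.SemiGraphs

end
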